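import Summits.Ventures.CertifiedArithmetic.LowPrec.LangeRumpToleranceZero

/-!
# Zero tolerance of the Lange–Rump restriction: the verdict in every format with p ≥ 5

HONEST FRAMING (venture CertifiedArithmetic / cell `pub-lowprec`): certified error envelopes and
provably optimal rounding/accumulation schemes for low-precision formats under stated cost models;
every table by two implementations; no hardware or vendor claims.

`LangeRumpToleranceZero.lean` computes, for every format `α` with `m ≥ 1` and range
`8H² + 8H ≤ maxScaled` (`H = 2^(m-1)`), the recursive summation of the data
`lrZeroData H q = (4H², 3H^{×H}, 2H+1, 2H, (-2H)^{×(H-1)})·q` (gemm.tex Prop. p:sharp, rescaled):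
`ŝₙ = (8H²+8H)q` at `n = 2H + 1 = ½u⁻¹ + 1` additions, `s = (5H²+6H+1)q`, `Σ|xᵢ| = (9H²+2H+1)q`.
Here: `(2H+1)/(6H+1)·(9H²+2H+1) < 3H²+2H-1 ⇔ 2H² - 8H - 2 > 0 ⇔ H ≥ 8 ⇔ m ≥ 4`, hence
* `LangeRumpZeroTolerance α` (the statement) and `langeRump_tolerance_zero`: in EVERY format with
  `m ≥ 4` (`p ≥ 5`) and that range, the Lange–Rump bound `n u/(1+n u)·Σ|xᵢ|` FAILS at the first
  excluded length `n = ½u⁻¹ + 1` — the tolerance of the restriction `n ≤ ½u⁻¹` under binary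
  ties-to-even is ZERO ([LangeRump2018, Remark 2] gives `≤ β/2 = 1`; gemm's Prop. p:sharp proved
  zero on paper for all `p ≥ 5` and by kernel for bfloat16 — this is the all-format theorem);
* `langeRump_restriction_sharp`: `AccumulateLangeRump`'s hypothesis `2 n u ≤ 1` cannot be
  weakened to `2 n u ≤ 1 + 2u`;
* instances by `decide` on the two side conditions: `_BFloat16` (`n = 129` — the length that
  `langeRump_fails_at_130_BFloat16` left open), `_Binary16` (`n = 1025`), `_Binary32` (`2²³ + 1`).
`p = 4` (E4M3, E2M3, binary8p4) is NOT covered: there `2H² - 8H - 2 < 0`, gemm's replay gives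
`55/153 < 9/25`, and implementation A's window scan finds no violating input at `n = 10` at all.
-/

namespace Literature.ComputerArithmetic.FloatingPoint

namespace MiniFloat

open Finset Format

variable {α : Format}

/-! ## §3 Zero tolerance -/

/-- The unit roundoff is `1/(4H)`, `H = 2^(m-1)` (`m ≥ 1`). -/
theorem unitRoundoff_eq_inv_four_mul (hm : 1 ≤ α.manBits) :
    α.unitRoundoff = 1 / (4 * ((2 ^ (α.manBits - 1) : ℕ) : ℚ)) := by
  have h : (2 : ℚ) ^ (α.manBits + 1) = 4 * ((2 ^ (α.manBits - 1) : ℕ) : ℚ) := by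
    push_cast
    rw [show α.manBits + 1 = (α.manBits - 1) + 2 by omega, pow_add]; ring
  rw [Format.unitRoundoff_eq, h]

/-- ZERO TOLERANCE IN FORMAT `α` (the statement): with `H = 2^(m-1)` and `q` one quantum, the data
`lrZeroData H q` are values of `α`, every step of their recursive summation is in range (at every
length), the number of additions `n = 2H + 1 = ½u⁻¹ + 1` is the first length excluded by
`2 n u ≤ 1` (`2 n u = 1 + 2u`), and `n u/(1 + n u) · Σ_{i≤n}|xᵢ| < |ŝₙ - Σ_{i≤n} xᵢ|`.
[cite: LangeRump2018, Remark 2] -/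
def LangeRumpZeroTolerance (α : Format) : Prop :=
    (∀ i, ∃ y : MiniFloat α, y.toRat = lrZeroData (2 ^ (α.manBits - 1)) α.quantum i) ∧
    (∀ k, InRange α (lrZeroData (2 ^ (α.manBits - 1)) α.quantum) k) ∧
    2 * ((2 * 2 ^ (α.manBits - 1) + 1 : ℕ) : ℚ) * α.unitRoundoff = 1 + 2 * α.unitRoundoff ∧
    ((2 * 2 ^ (α.manBits - 1) + 1 : ℕ) : ℚ) * α.unitRoundoff
        / (1 + ((2 * 2 ^ (α.manBits - 1) + 1 : ℕ) : ℚ) * α.unitRoundoff)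
        * ∑ i ∈ range (2 * 2 ^ (α.manBits - 1) + 1 + 1),
            |lrZeroData (2 ^ (α.manBits - 1)) α.quantum i|
      < |(seqSum α (lrZeroData (2 ^ (α.manBits - 1)) α.quantum) (2 * 2 ^ (α.manBits - 1) + 1)).toRat
          - ∑ i ∈ range (2 * 2 ^ (α.manBits - 1) + 1 + 1),
              lrZeroData (2 ^ (α.manBits - 1)) α.quantum i|

/-- **THE LANGE–RUMP RESTRICTION HAS ZERO TOLERANCE** (gemm.tex Prop. p:sharp) in every format with
`m ≥ 4` (`p ≥ 5`) and range `8H² + 8H ≤ maxScaled`, `H = 2^(m-1)`: the data `lrZeroData H q` are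
values of `α`, every step of their recursive summation is in range, the number of additions is
`n = 2H + 1 = ½u⁻¹ + 1` (the first length excluded by `2 n u ≤ 1`), and
`n u/(1 + n u) · Σ|xᵢ| < |ŝₙ - Σ xᵢ|` (`= (2H+1)/(6H+1)·(9H²+2H+1)q < (3H²+2H-1)q`).
[cite: LangeRump2018, Remark 2] -/
theorem langeRump_tolerance_zero (hm : 4 ≤ α.manBits)
    (hR : 8 * (2 ^ (α.manBits - 1)) ^ 2 + 8 * 2 ^ (α.manBits - 1) ≤ α.maxScaled) :
    LangeRumpZeroTolerance α := by
  unfold LangeRumpZeroTolerance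
  have h1 : 1 ≤ α.manBits := by omega
  have hq := α.quantum_pos
  have hu := unitRoundoff_eq_inv_four_mul (α := α) h1
  have hH8 : (8 : ℚ) ≤ ((2 ^ (α.manBits - 1) : ℕ) : ℚ) := by
    have : 2 ^ 3 ≤ 2 ^ (α.manBits - 1) := Nat.pow_le_pow_right (by norm_num) (by omega)
    exact_mod_cast this
  obtain ⟨hS, hΛ, hŝ⟩ := lrZero_sums h1 hR
  refine ⟨lrZero_mem h1 hR, lrZero_inRange h1 hR, ?_, ?_⟩
  · rw [hu]; push_cast; field_simp; ring
  rw [hS, hΛ, hŝ, hu]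
  set Hq : ℚ := ((2 ^ (α.manBits - 1) : ℕ) : ℚ) with hHq
  have hH0 : 0 < Hq := by linarith
  rw [show (8 * Hq ^ 2 + 8 * Hq) * α.quantum - (5 * Hq ^ 2 + 6 * Hq + 1) * α.quantum
      = (3 * Hq ^ 2 + 2 * Hq - 1) * α.quantum by ring, abs_of_pos (by nlinarith)]
  have hc : ((2 * (2 ^ (α.manBits - 1) : ℕ) + 1 : ℕ) : ℚ) = 2 * Hq + 1 := by
    rw [hHq]; push_cast; ring
  have key : ((2 * (2 ^ (α.manBits - 1) : ℕ) + 1 : ℕ) : ℚ) * (1 / (4 * Hq))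
      / (1 + ((2 * (2 ^ (α.manBits - 1) : ℕ) + 1 : ℕ) : ℚ) * (1 / (4 * Hq)))
      = (2 * Hq + 1) / (6 * Hq + 1) := by
    rw [hc]; field_simp; ring
  rw [key, div_mul_eq_mul_div, div_lt_iff₀ (by linarith)]
  have hpoly : 0 < 2 * Hq ^ 2 - 8 * Hq - 2 := by nlinarith
  nlinarith [mul_pos hq hpoly]

/-- **COROLLARY**: in every such format the hypothesis `2 n u ≤ 1` of the Lange–Rump theorem
(`abs_seqSum_sub_sum_le_langeRump`) cannot be weakened to `2 n u ≤ 1 + 2u` — not by a single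
addition. [cite: LangeRump2018, Remark 2] -/
theorem langeRump_restriction_sharp (hm : 4 ≤ α.manBits)
    (hR : 8 * (2 ^ (α.manBits - 1)) ^ 2 + 8 * 2 ^ (α.manBits - 1) ≤ α.maxScaled) :
    ¬ ∀ (x : ℕ → ℚ) (n : ℕ), (∀ i ≤ n, ∃ y : MiniFloat α, y.toRat = x i) → InRange α x n →
        2 * (n : ℚ) * α.unitRoundoff ≤ 1 + 2 * α.unitRoundoff →
        |(seqSum α x n).toRat - ∑ i ∈ range (n + 1), x i|
          ≤ (n : ℚ) * α.unitRoundoff / (1 + (n : ℚ) * α.unitRoundoff)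
            * ∑ i ∈ range (n + 1), |x i| := by
  intro h
  obtain ⟨hmem, hin, hn, hlt⟩ := langeRump_tolerance_zero (α := α) hm hR
  have := h (lrZeroData (2 ^ (α.manBits - 1)) α.quantum) (2 * 2 ^ (α.manBits - 1) + 1)
    (fun i _ => hmem i) (hin _) (by rw [hn])
  exact absurd this (not_le.mpr hlt)

/-! ## §4 Instances (range side conditions by `decide`) -/

/-- bfloat16 (`m = 7`, `H = 64`, `u = 2^-8`, `n = 129`): zero tolerance — the case left open by
`langeRump_fails_at_130_BFloat16` (gemm's Prop. p:sharp input `(2¹⁸, 3072^×64, 2064, 2048,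
-2048^×63)` is these data scaled by `2^12`). -/
theorem langeRump_tolerance_zero_BFloat16 : LangeRumpZeroTolerance Format.BFloat16 :=
  langeRump_tolerance_zero (by decide) (by decide)

/-- binary16 (`m = 10`, `H = 512`, `n = 1025`): zero tolerance. -/
theorem langeRump_tolerance_zero_Binary16 : LangeRumpZeroTolerance Format.Binary16 :=
  langeRump_tolerance_zero (by decide) (by decide)

/-- binary32 (`m = 23`, `H = 2²²`, `n = 2²³ + 1`): zero tolerance. -/
theorem langeRump_tolerance_zero_Binary32 : LangeRumpZeroTolerance Format.Binary32 :=
  langeRump_tolerance_zero (by decide) (by decide)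

/-! ## §5 `p = 4`: the tolerance is ONE (E4M3 kernel witness at `n = ½u⁻¹ + 2`) -/

/-- E4M3 (`p = 4`, `u = 1/16`, `½u⁻¹ = 8`): the theorem above does not apply (`m = 3`), and indeed
implementation A (opt's `tree_poly_law_A.py`, window of 10 binades) finds NO input of length 10
(`n = 9 = ½u⁻¹ + 1` additions, any summation tree) exceeding `9u/(1+9u) = 9/25` — tolerance at
least one at `p = 4` (evidence, not a theorem).  The tolerance is not two: the data
`(-16, -3, -3, -3, -3, -9/4, -2, 2, 2, 2, 2)` (gemm's climb with `U = 2`: four ties `ŝ + 3` resolved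
to even, `-9/4`, `-2`, then four `+2` on the stationary tie) have `n = 10 = ½u⁻¹ + 2` additions,
`ŝ = -40`, `s = -97/4`, `Σ|xᵢ| = 161/4`: `|ŝ - s|/Σ|xᵢ| = 9/23 > 10u/(1+10u) = 5/13`.  Kernel replay
(all data are E4M3 values; every step in range: magnitudes ≤ 40 < 448). -/
theorem langeRump_fails_at_10_E4M3 :
    (∀ i ≤ 10, ∃ y : MiniFloat Format.E4M3, y.toRat
        = (fun i : ℕ => if i = 0 then (-16 : ℚ) else if i ≤ 4 then -3 else if i = 5 then -9 / 4
            else if i = 6 then -2 else 2) i) ∧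
    (seqSum Format.E4M3 (fun i : ℕ => if i = 0 then (-16 : ℚ) else if i ≤ 4 then -3
        else if i = 5 then -9 / 4 else if i = 6 then -2 else 2) 10).toRat = -40 ∧
    ∑ i ∈ range 11, (fun i : ℕ => if i = 0 then (-16 : ℚ) else if i ≤ 4 then -3
        else if i = 5 then -9 / 4 else if i = 6 then -2 else 2) i = -97 / 4 ∧
    ∑ i ∈ range 11, |(fun i : ℕ => if i = 0 then (-16 : ℚ) else if i ≤ 4 then -3
        else if i = 5 then -9 / 4 else if i = 6 then -2 else 2) i| = 161 / 4 ∧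
    (10 : ℚ) * Format.E4M3.unitRoundoff / (1 + 10 * Format.E4M3.unitRoundoff) * (161 / 4)
      < |(-40 : ℚ) - (-97 / 4)| := by
  refine ⟨?_, by decide +kernel, by decide +kernel, by decide +kernel, ?_⟩
  · intro i hi
    have hall : ∀ j ∈ List.range 11, (roundNE Format.E4M3 ((fun i : ℕ => if i = 0 then (-16 : ℚ)
        else if i ≤ 4 then -3 else if i = 5 then -9 / 4 else if i = 6 then -2 else 2) j)).toRat
        = (fun i : ℕ => if i = 0 then (-16 : ℚ) else if i ≤ 4 then -3 else if i = 5 then -9 / 4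
            else if i = 6 then -2 else 2) j := by
      decide +kernel
    exact ⟨_, hall i (List.mem_range.mpr (by omega))⟩
  · rw [Format.unitRoundoff_eq]; norm_num [Format.E4M3, abs_of_neg]

end MiniFloat

end Literature.ComputerArithmetic.FloatingPoint
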